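import Literature.AlgebraicGeometry.HodgeTheory.ComplexOrientationDegreeFibre
import Literature.AlgebraicGeometry.Motives.ComplexPointsEtaleLocalHomeomorph
import HarnessLib

/-!
# The degree over a fibre in the étale locus: `q_* 1 = k • 1` from algebraic hypotheses

Family `hodge`, layer `Literature/AlgebraicGeometry/HodgeTheory`. `HodgeTheory/ComplexOrientationDegreeFibre`
proves Fulton's degree formula `q_* 1 = (#fibre) • 1` (Lemma 19.1.2, complex orientations) for a
morphism `q : T ⟶ W` of smooth projective `d`-folds over a fibre all of whose complex points are
points where `q(ℂ)` is a local homeomorphism — an ANALYTIC hypothesis. This file converts it into the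
ALGEBRAIC one used in practice (SGA 1 XII 3.1 (iii): `q` étale near `P` ⇒ `q(ℂ)` a local isomorphism
near `P`): it suffices that the fibre lies in an open `U' ⊆ T` on which `q` is smooth (= étale, the
dimensions being equal).

* `exists_openPartialHomeomorph_extend` — topology: an open partial homeomorphism `e' : Y ⇀ X` with
  total function `F ∘ j`, `j : Y → X'` an open embedding, extends to one `X' ⇀ X` through `j y` with
  total function `F`;
* `exists_openPartialHomeomorph_map_of_smooth` — for `P ∈ U'(ℂ)` with `U'.ι ≫ q` smooth, `q(ℂ)` is
  an open partial homeomorphism near `P` (`Motives.ComplexPoints.isLocalHomeomorph_map` on the open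
  subscheme `U'`, extended);
* `complexGysin_complexOrientationFamily_one_of_fibre_subset_smoothLocus` — **`q_* 1 = (#ι) • 1`**
  for the complex orientations when the fibre `q(ℂ)⁻¹(b) = {v i}ᵢ` lies in such a `U'`
  (`complexGysin_complexOrientationFamily_one_of_finite_fibre`).

Everything is proved; no definitions, no named facts.

## References

* [Fulton1998] W. Fulton, Intersection Theory, 2nd ed., Springer 1998, Lemma 19.1.2.
* [SGA1] A. Grothendieck, M. Raynaud, SGA 1, Exp. XII Prop. 3.1 (iii).
-/

noncomputable section

open scoped Topology
open CategoryTheory AlgebraicGeometry Set Filter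
open Literature.AlgebraicTopology.SingularHomology Literature.Topology.FourManifolds

namespace Literature.AlgebraicGeometry.HodgeTheory

/-! ### Extending a local homeomorphism along an open embedding -/

section Extend

variable {Y X' X : Type*} [TopologicalSpace Y] [TopologicalSpace X'] [TopologicalSpace X]

/-- **Extension of a local homeomorphism along an open embedding.** If `e' : Y ⇀ X` is an open
partial homeomorphism whose total function is `F ∘ j` for a continuous `F : X' → X` and an open
embedding `j : Y → X'`, and `y ∈ e'.source`, then there is an open partial homeomorphism
`e : X' ⇀ X` with total function `F` and `j y ∈ e.source` (source `j '' e'.source`, inverse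
`j ∘ e'⁻¹`). [folklore] -/
theorem exists_openPartialHomeomorph_extend {F : X' → X} (hF : Continuous F) {j : Y → X'}
    (hj : Topology.IsOpenEmbedding j) (e' : OpenPartialHomeomorph Y X)
    (he' : (e' : Y → X) = F ∘ j) {y : Y} (hy : y ∈ e'.source) :
    ∃ e : OpenPartialHomeomorph X' X, j y ∈ e.source ∧ (e : X' → X) = F := by
  have hFj : ∀ z, F (j z) = e' z := fun z ↦ (congr_fun he' z).symm
  let e : OpenPartialHomeomorph X' X :=
    { toFun := F
      invFun := fun t ↦ j (e'.symm t)
      source := j '' e'.source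
      target := e'.target
      map_source' := by
        rintro _ ⟨z, hz, rfl⟩
        rw [hFj]
        exact e'.map_source hz
      map_target' := fun t ht ↦ ⟨e'.symm t, e'.map_target ht, rfl⟩
      left_inv' := by
        rintro _ ⟨z, hz, rfl⟩
        rw [hFj, e'.left_inv hz]
      right_inv' := fun t ht ↦ by rw [hFj, e'.right_inv ht]
      open_source := hj.isOpenMap _ e'.open_source
      open_target := e'.open_target
      continuousOn_toFun := hF.continuousOn
      continuousOn_invFun := (hj.continuous.comp_continuousOn e'.continuousOn_symm) }
  exact ⟨e, ⟨y, hy, rfl⟩, rfl⟩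

end Extend

section HodgeTheory

open Literature.AlgebraicGeometry.Motives

variable {d : ℕ} {T W : Motives.SchemeOver ℂ}

/-- **`q(ℂ)` is a local homeomorphism at the complex points of an open on which `q` is smooth.**
For `q : T ⟶ W` between `ℂ`-schemes smooth of relative dimension `d` and locally of finite type, an
open `U' ⊆ T` with `U' ↪ T → W` smooth (equivalently étale), and a complex point `P` of `T` with
`pt P ∈ U'`, there is an open partial homeomorphism `e : T(ℂ) ⇀ W(ℂ)` with total function `q(ℂ)`
and `P ∈ e.source` (SGA 1 XII 3.1 (iii) on the open subscheme `U'`,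
`Motives.ComplexPoints.isLocalHomeomorph_map`, extended along `U'(ℂ) ↪ T(ℂ)`).
[cite: SGA1, Exp. XII Prop. 3.1 (iii)] -/
theorem exists_openPartialHomeomorph_map_of_smooth [LocallyOfFiniteType T.hom]
    [SmoothOfRelativeDimension d T.hom] [LocallyOfFiniteType W.hom] [SmoothOfRelativeDimension d W.hom]
    (q : T ⟶ W) (U' : T.left.Opens) [Smooth (U'.ι ≫ q.left)] (P : ComplexPoints T) (hP : P.pt ∈ U') :
    ∃ e : OpenPartialHomeomorph (ComplexPoints T) (ComplexPoints W),
      P ∈ e.source ∧ (e : ComplexPoints T → ComplexPoints W) = AlgPoints.map q := by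
  set Ti : SchemeOver ℂ := openSubschemeOver T U' with hTi
  set j : Ti ⟶ T := openSubschemeOverι T U' with hj
  haveI : IsOpenImmersion j.left := inferInstanceAs (IsOpenImmersion U'.ι)
  haveI : LocallyOfFiniteType Ti.hom := inferInstanceAs (LocallyOfFiniteType (U'.ι ≫ T.hom))
  haveI : SmoothOfRelativeDimension d Ti.hom := by
    have h : SmoothOfRelativeDimension (0 + d) (U'.ι ≫ T.hom) := inferInstance
    rw [Nat.zero_add] at h
    exact h
  haveI : Smooth (j ≫ q).left := inferInstanceAs (Smooth (U'.ι ≫ q.left))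
  have hrange : Set.range (AlgPoints.map (L := ℂ) j) = {Q : ComplexPoints T | Q.pt ∈ U'} := by
    rw [AlgPoints.range_map_of_isOpenImmersion_holds j]
    ext Q
    change Q.pt ∈ U'.ι.opensRange ↔ Q.pt ∈ U'
    rw [Scheme.Opens.opensRange_ι]
  obtain ⟨y, hy⟩ : P ∈ Set.range (AlgPoints.map (L := ℂ) j) := by
    rw [hrange]
    exact hP
  obtain ⟨e', hye', he'⟩ := ComplexPoints.isLocalHomeomorph_map d (j ≫ q) y
  have he'' : (e' : ComplexPoints Ti → ComplexPoints W) = AlgPoints.map q ∘ AlgPoints.map j := by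
    rw [← he']
    funext z
    exact AlgPoints.map_comp_apply _ _ _
  obtain ⟨e, hje, he⟩ := exists_openPartialHomeomorph_extend
    (AlgPoints.mapContinuous (L := ℂ) q).continuous (AlgPoints.isOpenEmbedding_map_holds j) e' he'' hye'
  refine ⟨e, ?_, he⟩
  rw [← hy]
  exact hje

/-- **`q_* 1 = (#ι) • 1` over a fibre in the smooth (étale) locus** — Fulton's degree formula
(Lemma 19.1.2) for the complex orientations with ALGEBRAIC hypotheses: `q : T ⟶ W` a morphism of
smooth projective `d`-folds, `U' ⊆ T` an open with `U' ↪ T → W` smooth, and `b` a complex point of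
`W` whose fibre `q(ℂ)⁻¹(b) = {v i}ᵢ` (`v` injective) lies in `U'(ℂ)`.
[cite: Fulton1998, Lemma 19.1.2] [cite: SGA1, Exp. XII Prop. 3.1 (iii)] -/
theorem complexGysin_complexOrientationFamily_one_of_fibre_subset_smoothLocus
    (hT : IsSmoothProjective d T) (hW : IsSmoothProjective d W) (q : T ⟶ W) (U' : T.left.Opens)
    [Smooth (U'.ι ≫ q.left)] {ι : Type} [Fintype ι] {v : ι → ComplexPoints T}
    (hv : Function.Injective v) {b : ComplexPoints W}
    (hfibre : (AlgPoints.map q) ⁻¹' {b} = Set.range v) (hvU' : ∀ i, (v i).pt ∈ U') :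
    complexGysin complexOrientationFamily hT hW q (rfl : 0 + 2 * d = 0 + 2 * d)
        (singularCohomology.one ℂ (ComplexPoints T)) =
      (Fintype.card ι : ℂ) • singularCohomology.one ℂ (ComplexPoints W) := by
  haveI : IsProper T.hom := IsSmoothProjective.isProper_holds hT
  haveI : IsProper W.hom := IsSmoothProjective.isProper_holds hW
  haveI := hT.smoothOfRelativeDimension
  haveI := hW.smoothOfRelativeDimension
  exact complexGysin_complexOrientationFamily_one_of_finite_fibre hT hW q hv hfibre
    fun i ↦ exists_openPartialHomeomorph_map_of_smooth (d := d) q U' (v i) (hvU' i)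

end HodgeTheory

end Literature.AlgebraicGeometry.HodgeTheory

end
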